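import Literature.NumberTheory.Automorphic.QuaternionCoordOrderLocalLiftProofs
import Literature.NumberTheory.Automorphic.GLnAdelicStructure
import Literature.NumberTheory.Automorphic.AdeleRingTopology
import Literature.NumberTheory.Automorphic.IdeleIdealClass
import HarnessLib

/-!
# `coordOrder_heckeDoubleCoset` from strong approximation in its finite-adelic form

Topic `NumberTheory/Automorphic`; third companion ("proofs") file of `QuaternionCoordOrder` for
its named fact `QuaternionAlgebra.coordOrder_heckeDoubleCoset`, on top of
`QuaternionCoordOrderLocalLiftProofs` (the fact from the `v`-adic density `D_v` of `O¹` in `O_v¹`)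
and `QuaternionCoordOrderHeckeProofs`. Theorems and auxiliary definitions only; no named fact.

Here the remaining input is brought to the exact shape of **Kneser's strong approximation
theorem** (Vignéras, LNM 800, Ch. III §4 Thm. 4.3 with `S = ∞`: if `ℍ[K,a,b]` is not totally
definite, `H¹_K H¹_∞` is dense in `H¹_A`, i.e. `H¹_K` is dense in the finite-adelic points
`H¹(𝔸_K^∞)`), stated concretely and without any topology on the quaternion algebra itself:

  `(SA_f)  for every y ∈ ℍ[𝔸_K^∞,a,b] with y ȳ = 1 and every open V ∋ 0 of 𝔸_K^∞ there is
           x ∈ ℍ[K,a,b] with x x̄ = 1 all four of whose coordinates differ from those of y by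
           elements of V`

(density of `ℍ¹` in `ℍ[𝔸_K^∞,a,b]¹` for the product topology of the coordinates `1, i, j, k`;
`ℍ[𝔸_K^∞,a,b] = ℍ⟮𝔸_K^∞; 𝓞 K; a, b⟯` is Mathlib's quaternion algebra over the finite adele ring, and
the coordinates of the diagonal image `ι(x)` (`toFiniteAdele`) of `x` are the finite adeles of the
coordinates of `x`).

* `normOne_adicCompletion_dense_of_finiteAdele_dense` : **`SA_f ⇒ D_v` at every finite place `v`**
  (the adelic bookkeeping: extend `y_v ∈ O_v¹` by `1` to `y ∈ ℍ[𝔸_K^∞,a,b]¹` (`extendOne`), apply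
  `SA_f` with the open set `V = {t ∈ 𝒪̂_K : v(t_v) < 1}` (`isOpen_integralFiniteAdeles`,
  continuity of evaluation at `v`); the global `x` has coordinates in `K ∩ 𝒪̂_K = 𝓞_K`
  (`HeightOneSpectrum.mem_integers_of_valuation_le_one`), so `x ∈ O¹`, and `x ≡ y_v (mod 𝔪_v O_v)`;
  Vignéras III §5 A Prop. 5.1, `X = V ∩ ∏_v X_v`).
* `coordOrder_heckeDoubleCoset_of_forall_finiteAdele_dense` : hence the named fact follows from
  `SA_f` for all non-totally-definite `ℍ[K,a,b]` (`a b ≠ 0`), i.e. from Vignéras III Thm. 4.3,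
  the only input of `coordOrder_heckeDoubleCoset` not yet in the tree.

## References

* M.-F. Vignéras, *Arithmétique des algèbres de quaternions*, LNM 800 (1980): Ch. III §1
  (adèles), §4 Thm. 4.3 (Kneser), §5 A Prop. 5.1 [VignerasLNM800].
* G. Shimura, *Introduction to the arithmetic theory of automorphic functions* (1971), §3.1,
  Prop. 3.1 [Shimura1971].
-/

noncomputable section

open scoped Quaternion Pointwise
open NumberField IsDedekindDomain

namespace Literature.NumberTheory.Automorphic

/-! ### Components of finite adeles (complements to `AdeleRingTopology`, `IdeleIdealClass`) -/

section FiniteAdele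

variable (R : Type*) [CommRing R] [IsDedekindDomain R] (K : Type*) [Field K] [Algebra R K]
  [IsFractionRing R K]

/-- Components of finite adeles add: `(x + y) v = x v + y v` (definitional). [folklore] -/
theorem FiniteAdeleRing.add_apply' (x y : FiniteAdeleRing R K) (v : HeightOneSpectrum R) :
    (x + y) v = x v + y v := rfl

/-- The components of `0` are `0` (definitional). [folklore] -/
theorem FiniteAdeleRing.zero_apply' (v : HeightOneSpectrum R) :
    (0 : FiniteAdeleRing R K) v = 0 := rfl

/-- Evaluation of finite adeles at a place is continuous (Mathlib
`RestrictedProduct.continuous_eval`). [folklore] -/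
theorem FiniteAdeleRing.continuous_apply' (v : HeightOneSpectrum R) :
    Continuous fun t : FiniteAdeleRing R K => t v :=
  RestrictedProduct.continuous_eval v

end FiniteAdele

namespace QuaternionAlgebra

/-- `ℍ⟮K; R; a, b⟯ := ℍ[K, algebraMap R K a, algebraMap R K b]` (file-local notation, as in
`QuaternionCoordOrder`). -/
local notation "ℍ⟮" K "; " R "; " a ", " b "⟯" =>
  QuaternionAlgebra K (algebraMap R K a) (0 : K) (algebraMap R K b)

/-! ### Norm one in coordinates -/

section NormOne

variable {T : Type*} [CommRing T] {c₁ c₃ : T}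

/-- `q q̄ = 1 ↔ q₀² - c₁ q₁² - c₃ q₂² + c₁ c₃ q₃² = 1` in `ℍ[T,c₁,c₃]` over any commutative ring
(`q q̄` is the scalar `n(q)`, Mathlib `QuaternionAlgebra.mul_star_eq_coe`; Vignéras I §1 Lemme 1.1).
[cite: VignerasLNM800, Ch. I §1 Lemme 1.1] -/
theorem mul_star_eq_one_iff_coords (q : ℍ[T,c₁,c₃]) :
    q * star q = 1 ↔ q.re ^ 2 - c₁ * q.imI ^ 2 - c₃ * q.imJ ^ 2 + c₁ * c₃ * q.imK ^ 2 = 1 := by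
  have h : (q * star q).re = q.re ^ 2 - c₁ * q.imI ^ 2 - c₃ * q.imJ ^ 2 + c₁ * c₃ * q.imK ^ 2 := by
    simp only [_root_.QuaternionAlgebra.re_mul, _root_.QuaternionAlgebra.re_star,
      _root_.QuaternionAlgebra.imI_star, _root_.QuaternionAlgebra.imJ_star,
      _root_.QuaternionAlgebra.imK_star]
    ring
  rw [_root_.QuaternionAlgebra.mul_star_eq_coe, h, ← _root_.QuaternionAlgebra.coe_one,
    (_root_.QuaternionAlgebra.coe_injective).eq_iff]

end NormOne

/-! ### The finite-adelic quaternion algebra `ℍ[𝔸_K^∞,a,b]` and the diagonal map -/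

section Adelic

variable {K : Type} [Field K] [NumberField K] (a b : 𝓞 K)

/-- `𝔸_K^∞`. -/
local notation "𝔸ᶠ" => FiniteAdeleRing (𝓞 K) K

/-- The **diagonal map `ι : ℍ[K,a,b] →ₐ[K] ℍ[𝔸_K^∞,a,b]`** into Mathlib's quaternion algebra
`ℍ⟮𝔸_K^∞; 𝓞 K; a, b⟯` over the finite adele ring (coordinatewise `K → 𝔸_K^∞`; the integral model
`intModelHom` over `K → 𝔸_K^∞`); the elements with coordinates in `𝒪̂_K = ∏_v 𝒪_v` form
`Ô = ∏_v O_v` (Vignéras III §1, Exemple 3: `H_A` in a basis of `H/K`; §5 A).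
[cite: VignerasLNM800, Ch. III §1 (Exemples) and §5 A] -/
def toFiniteAdele : ℍ⟮K; 𝓞 K; a, b⟯ →ₐ[K] ℍ⟮𝔸ᶠ; 𝓞 K; a, b⟯ :=
  intModelHom (FiniteAdeleRing (𝓞 K) K) (algebraMap (𝓞 K) K a) (algebraMap (𝓞 K) K b)

/-- `ι` in coordinates. [folklore] -/
theorem toFiniteAdele_apply (x : ℍ⟮K; 𝓞 K; a, b⟯) :
    toFiniteAdele a b x = ⟨algebraMap K 𝔸ᶠ x.re, algebraMap K 𝔸ᶠ x.imI, algebraMap K 𝔸ᶠ x.imJ,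
      algebraMap K 𝔸ᶠ x.imK⟩ :=
  intModelHom_apply _ _ _ x

variable (v : HeightOneSpectrum (𝓞 K))

/-- `K_v`. -/
local notation "Kᵥ" => HeightOneSpectrum.adicCompletion K v

/-- `𝒪_v`. -/
local notation "𝒪ᵥ" => HeightOneSpectrum.adicCompletionIntegers K v

/-- `a` as an element of `𝒪_v`. -/
local notation "aᵥ" => algebraMap (𝓞 K) (HeightOneSpectrum.adicCompletionIntegers K v) a

/-- `b` as an element of `𝒪_v`. -/
local notation "bᵥ" => algebraMap (𝓞 K) (HeightOneSpectrum.adicCompletionIntegers K v) b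

/-- The `v`-component of the finite adele of `k ∈ K` is `k ∈ K_v`. [folklore] -/
theorem algebraMap_finiteAdele_apply (k : K) :
    algebraMap K 𝔸ᶠ k v = algebraMap K Kᵥ k := by
  rw [FiniteAdeleRing.algebraMap_apply]
  exact adicCompletion_coe_eq_algebraMap (𝓞 K) K v k

/-- The finite adele `t` with its `v`-component replaced by `c`. [folklore] -/
def withComponent (t : 𝔸ᶠ) (c : Kᵥ) : 𝔸ᶠ :=
  t + finiteAdeleSingleHom K v (c - t v)

/-- The `v`-component of `withComponent v t c` is `c`. [folklore] -/
@[simp]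
theorem withComponent_apply_self (t : 𝔸ᶠ) (c : Kᵥ) : withComponent v t c v = c := by
  rw [withComponent, FiniteAdeleRing.add_apply', finiteAdeleSingleHom_apply_self]
  abel

/-- Away from `v`, `withComponent v t c` agrees with `t`. [folklore] -/
theorem withComponent_apply_of_ne (t : 𝔸ᶠ) (c : Kᵥ) {w : HeightOneSpectrum (𝓞 K)} (h : w ≠ v) :
    withComponent v t c w = t w := by
  rw [withComponent, FiniteAdeleRing.add_apply', finiteAdeleSingleHom_apply_of_ne K v _ h,
    add_zero]

/-- `withComponent v t c ∈ 𝒪̂_K` when `t ∈ 𝒪̂_K` and `c ∈ 𝒪_v`. [folklore] -/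
theorem withComponent_mem_integralFiniteAdeles {t : 𝔸ᶠ} (ht : t ∈ integralFiniteAdeles K) {c : Kᵥ}
    (hc : c ∈ HeightOneSpectrum.adicCompletionIntegers K v) :
    withComponent v t c ∈ integralFiniteAdeles K := by
  intro w
  by_cases hw : w = v
  · subst hw
    rw [withComponent_apply_self]
    exact hc
  · rw [withComponent_apply_of_ne v t c hw]
    exact ht w

/-- **Extension by `1`**: the element `(y at v, 1 elsewhere)` of `ℍ[𝔸_K^∞,a,b]` attached to
`y ∈ ℍ[K_v,a,b]` (the local factor `H_v ⊆ H_A`, Vignéras III §1). [cite: VignerasLNM800, Ch. III §1 (adèles, Exemple 3)] -/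
def extendOne (y : ℍ⟮Kᵥ; 𝒪ᵥ; aᵥ, bᵥ⟯) : ℍ⟮𝔸ᶠ; 𝓞 K; a, b⟯ :=
  ⟨withComponent v 1 y.re, withComponent v 0 y.imI, withComponent v 0 y.imJ,
    withComponent v 0 y.imK⟩

/-- If `y ∈ O_v` then `extendOne v y` has coordinates in `𝒪̂_K` (`∈ Ô`). [folklore] -/
theorem extendOne_mem {y : ℍ⟮Kᵥ; 𝒪ᵥ; aᵥ, bᵥ⟯} (hy : y ∈ coordOrder Kᵥ aᵥ bᵥ) :
    (extendOne a b v y).re ∈ integralFiniteAdeles K ∧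
      (extendOne a b v y).imI ∈ integralFiniteAdeles K ∧
      (extendOne a b v y).imJ ∈ integralFiniteAdeles K ∧
      (extendOne a b v y).imK ∈ integralFiniteAdeles K := by
  rw [mem_coordOrder_iff'] at hy
  obtain ⟨⟨o₀, h₀⟩, ⟨o₁, h₁⟩, ⟨o₂, h₂⟩, ⟨o₃, h₃⟩⟩ := hy
  have h1 : (1 : 𝔸ᶠ) ∈ integralFiniteAdeles K := one_mem _
  have h0 : (0 : 𝔸ᶠ) ∈ integralFiniteAdeles K := zero_mem _
  exact ⟨withComponent_mem_integralFiniteAdeles v h1 (h₀ ▸ o₀.2),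
    withComponent_mem_integralFiniteAdeles v h0 (h₁ ▸ o₁.2),
    withComponent_mem_integralFiniteAdeles v h0 (h₂ ▸ o₂.2),
    withComponent_mem_integralFiniteAdeles v h0 (h₃ ▸ o₃.2)⟩

/-- The `v`-component of the structure constant `a` of `ℍ[𝔸_K^∞,a,b]` is the structure constant
of `ℍ[K_v,a,b]` (`FiniteAdeleRing.algebraMap_int_apply` of `AdeleRingTopology`). [folklore] -/
theorem algebraMap_integers_finiteAdele_apply (r : 𝓞 K) :
    algebraMap (𝓞 K) 𝔸ᶠ r v = algebraMap 𝒪ᵥ Kᵥ (algebraMap (𝓞 K) 𝒪ᵥ r) :=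
  FiniteAdeleRing.algebraMap_int_apply (𝓞 K) K r v

/-- `y ȳ = 1` in `ℍ[K_v,a,b]` gives `Y Ȳ = 1` for the extension by `1`, `Y = extendOne v y`
(componentwise: the norm form at `v`, and `1` elsewhere). [cite: VignerasLNM800, Ch. I §1 Lemme 1.1] -/
theorem extendOne_mul_star {y : ℍ⟮Kᵥ; 𝒪ᵥ; aᵥ, bᵥ⟯} (hy : y * star y = 1) :
    extendOne a b v y * star (extendOne a b v y) = 1 := by
  rw [mul_star_eq_one_iff_coords] at hy ⊢
  refine FiniteAdeleRing.ext K fun w => ?_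
  simp only [pow_two, FiniteAdeleRing.mul_apply', FiniteAdeleRing.sub_apply',
    FiniteAdeleRing.add_apply', FiniteAdeleRing.coe_one_apply, algebraMap_integers_finiteAdele_apply]
  by_cases hw : w = v
  · subst hw
    simp only [extendOne, withComponent_apply_self]
    simpa only [pow_two] using hy
  · simp only [extendOne, withComponent_apply_of_ne v _ _ hw, FiniteAdeleRing.coe_one_apply,
      FiniteAdeleRing.zero_apply']
    ring

/-- `x ∈ O` as soon as the coordinates of `ι(x)` lie in `𝒪̂_K` (`K ∩ ∏_v 𝒪_v = 𝓞_K`, Mathlib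
`HeightOneSpectrum.mem_integers_of_valuation_le_one`; Vignéras III §5 A Prop. 5.1).
[cite: VignerasLNM800, Ch. III §5 Prop. 5.1] -/
theorem mem_coordOrder_of_toFiniteAdele_mem {x : ℍ⟮K; 𝓞 K; a, b⟯}
    (h₀ : (toFiniteAdele a b x).re ∈ integralFiniteAdeles K)
    (h₁ : (toFiniteAdele a b x).imI ∈ integralFiniteAdeles K)
    (h₂ : (toFiniteAdele a b x).imJ ∈ integralFiniteAdeles K)
    (h₃ : (toFiniteAdele a b x).imK ∈ integralFiniteAdeles K) : x ∈ coordOrder K a b := by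
  rw [toFiniteAdele_apply] at h₀ h₁ h₂ h₃
  have hint : ∀ {k : K}, algebraMap K 𝔸ᶠ k ∈ integralFiniteAdeles K →
      k ∈ Set.range (algebraMap (𝓞 K) K) := fun {k} hk => by
    obtain ⟨r, hr⟩ := exists_algebraMap_eq_of_forall_coe_mem (𝓞 K) K k fun w => hk w
    exact ⟨r, hr⟩
  rw [mem_coordOrder_iff']
  exact ⟨hint h₀, hint h₁, hint h₂, hint h₃⟩

/-- Two elements of `O_v` whose coordinates differ by elements of valuation `< 1` are congruent
modulo `𝔪_v O_v`. [folklore] -/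
theorem sub_mem_idealLattice_maximalIdeal {p q : ℍ⟮Kᵥ; 𝒪ᵥ; aᵥ, bᵥ⟯}
    (h₀ : Valued.v (p.re - q.re) < 1) (h₁ : Valued.v (p.imI - q.imI) < 1)
    (h₂ : Valued.v (p.imJ - q.imJ) < 1) (h₃ : Valued.v (p.imK - q.imK) < 1) :
    p - q ∈ idealLattice Kᵥ aᵥ bᵥ (IsLocalRing.maximalIdeal 𝒪ᵥ) := by
  rw [mem_idealLattice_iff_exists]
  refine ⟨⟨p.re - q.re, le_of_lt h₀⟩, ?_, ⟨p.imI - q.imI, le_of_lt h₁⟩, ?_,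
    ⟨p.imJ - q.imJ, le_of_lt h₂⟩, ?_, ⟨p.imK - q.imK, le_of_lt h₃⟩, ?_, by ext <;> rfl⟩ <;>
    exact (mem_maximalIdeal_adicCompletionIntegers_iff v).mpr ‹_›

/-- `{t : v(t) < 1}` is open in `K_v` (Mathlib `Valued.isOpen_ball`). [folklore] -/
theorem isOpen_valued_lt_one : IsOpen {c : Kᵥ | Valued.v c < 1} := by
  have h := Valued.isOpen_ball Kᵥ (1 : MonoidWithZeroHom.ValueGroup₀ _)
  simp only [Valuation.restrict_lt_one_iff] at h
  exact h

/-- **`SA_f ⇒ D_v`.** Strong approximation in its finite-adelic form — `ℍ¹` is dense in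
`ℍ[𝔸_K^∞,a,b]¹` for the coordinate topology (Vignéras III §4 Thm. 4.3, `S = ∞`) — implies, at every
finite place `v`, the `v`-adic density of `O¹` in `O_v¹` modulo `𝔪_v O_v`
(the hypothesis of `coordOrder_heckeDoubleCoset_of_forall_adicCompletion_dense`): extend
`y ∈ O_v¹` by `1` to `ℍ[𝔸_K^∞,a,b]¹`, approximate within the open set `{t ∈ 𝒪̂_K : v(t_v) < 1}`;
the approximating `x ∈ ℍ¹` lies in `ℍ ∩ Ô = O` and is congruent to `y` modulo `𝔪_v O_v`.
[cite: VignerasLNM800, Ch. III §4 Thm. 4.3 and §5 Prop. 5.1] -/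
theorem normOne_adicCompletion_dense_of_finiteAdele_dense
    (hSA : ∀ y : ℍ⟮𝔸ᶠ; 𝓞 K; a, b⟯, y * star y = 1 →
      ∀ V : Set 𝔸ᶠ, IsOpen V → (0 : 𝔸ᶠ) ∈ V →
        ∃ x : ℍ⟮K; 𝓞 K; a, b⟯, x * star x = 1 ∧ algebraMap K 𝔸ᶠ x.re - y.re ∈ V ∧
          algebraMap K 𝔸ᶠ x.imI - y.imI ∈ V ∧ algebraMap K 𝔸ᶠ x.imJ - y.imJ ∈ V ∧
          algebraMap K 𝔸ᶠ x.imK - y.imK ∈ V) :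
    ∀ y ∈ coordOrder Kᵥ aᵥ bᵥ, y * star y = 1 →
      ∃ u ∈ normOneGroup K a b,
        toAdicCompletion a b v (u : ℍ⟮K; 𝓞 K; a, b⟯) - y ∈
          idealLattice Kᵥ aᵥ bᵥ (IsLocalRing.maximalIdeal 𝒪ᵥ) := by
  intro y hyO hy1
  -- the open set `V = {t ∈ 𝒪̂ : v(t_v) < 1}`
  set V : Set 𝔸ᶠ := {t | t ∈ integralFiniteAdeles K ∧ Valued.v (t v) < 1} with hV
  have hVopen : IsOpen V :=
    (isOpen_integralFiniteAdeles K).inter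
      ((isOpen_valued_lt_one v).preimage (FiniteAdeleRing.continuous_apply' (𝓞 K) K v))
  have hV0 : (0 : 𝔸ᶠ) ∈ V := ⟨zero_mem _, by
    rw [FiniteAdeleRing.zero_apply', map_zero]
    exact zero_lt_one⟩
  obtain ⟨x, hx1, h₀, h₁, h₂, h₃⟩ :=
    hSA (extendOne a b v y) (extendOne_mul_star a b v hy1) V hVopen hV0
  obtain ⟨hY₀, hY₁, hY₂, hY₃⟩ := extendOne_mem a b v hyO
  -- `x ∈ O`: its coordinates are in `K ∩ 𝒪̂ = 𝓞 K`
  have hxO : x ∈ coordOrder K a b := by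
    refine mem_coordOrder_of_toFiniteAdele_mem a b ?_ ?_ ?_ ?_ <;> rw [toFiniteAdele_apply]
    · simpa using add_mem h₀.1 hY₀
    · simpa using add_mem h₁.1 hY₁
    · simpa using add_mem h₂.1 hY₂
    · simpa using add_mem h₃.1 hY₃
  -- `x ∈ O¹`
  let u : (ℍ⟮K; 𝓞 K; a, b⟯)ˣ := ⟨x, star x, hx1, by rw [star_comm_self', hx1]⟩
  have hu : u ∈ normOneGroup K a b := ⟨⟨hxO, star_mem_coordOrder hxO⟩, hx1⟩
  refine ⟨u, hu, ?_⟩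
  -- congruence at `v`
  have hv₀ := h₀.2
  have hv₁ := h₁.2
  have hv₂ := h₂.2
  have hv₃ := h₃.2
  simp only [extendOne, FiniteAdeleRing.sub_apply', withComponent_apply_self,
    algebraMap_finiteAdele_apply] at hv₀ hv₁ hv₂ hv₃
  refine sub_mem_idealLattice_maximalIdeal a b v ?_ ?_ ?_ ?_ <;>
    simp only [toAdicCompletion_apply] <;> assumption

end Adelic

/-! ### The named fact from finite-adelic strong approximation -/

section NumberField

variable {K : Type} [Field K] [NumberField K]

/-- **`coordOrder_heckeDoubleCoset` follows from Kneser's strong approximation theorem in its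
finite-adelic form** — for every number field `K` and `a, b ∈ 𝓞 K ∖ 0` with `ℍ[K,a,b]` not totally
definite, `ℍ¹` is dense in `ℍ[𝔸_K^∞,a,b]¹` for the coordinate topology (Vignéras III §4 Thm. 4.3,
`S = ∞`, Eichler's condition) — by `normOne_adicCompletion_dense_of_finiteAdele_dense` and
`coordOrder_heckeDoubleCoset_of_forall_adicCompletion_dense`. This isolates Thm. 4.3 as the only
input of the named fact that is not in the tree. [cite: VignerasLNM800, Ch. III §4 Thm. 4.3] [cite: Shimura1971, Prop. 3.1] -/
theorem coordOrder_heckeDoubleCoset_of_forall_finiteAdele_dense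
    (H : ∀ (K : Type) [Field K] [NumberField K] (a b : 𝓞 K), a ≠ 0 → b ≠ 0 →
      ¬ IsTotallyDefinite K ℍ⟮K; 𝓞 K; a, b⟯ →
      ∀ y : ℍ⟮FiniteAdeleRing (𝓞 K) K; 𝓞 K; a, b⟯, y * star y = 1 →
        ∀ V : Set (FiniteAdeleRing (𝓞 K) K), IsOpen V → (0 : FiniteAdeleRing (𝓞 K) K) ∈ V →
          ∃ x : ℍ⟮K; 𝓞 K; a, b⟯, x * star x = 1 ∧
            algebraMap K (FiniteAdeleRing (𝓞 K) K) x.re - y.re ∈ V ∧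
            algebraMap K (FiniteAdeleRing (𝓞 K) K) x.imI - y.imI ∈ V ∧
            algebraMap K (FiniteAdeleRing (𝓞 K) K) x.imJ - y.imJ ∈ V ∧
            algebraMap K (FiniteAdeleRing (𝓞 K) K) x.imK - y.imK ∈ V) :
    coordOrder_heckeDoubleCoset :=
  coordOrder_heckeDoubleCoset_of_forall_adicCompletion_dense fun K _ _ a b ha hb hdef v _ =>
    normOne_adicCompletion_dense_of_finiteAdele_dense a b v (H K a b ha hb hdef)

end NumberField

end QuaternionAlgebra

end Literature.NumberTheory.Automorphic
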